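import Mathlib
import Literature.Analysis.FluidPDE.VectorCalculus

/-!
TriageR1K3FrobeniusVsOpNorm (= the seat's Scratch.lean) — crux-triage r1 k3, crux FarPastLedger (stmt-NavierStokesRegularity-14060).

Check for card `test-side-leray-projection`: its first lemma `ProjectedEnergyIdentity`
(Cruxes/FarPastLedger/Ideator3Sketch.lean) writes the dissipation as
`∫ φ x * ‖fderiv ℝ (u τ) x‖ ^ 2` — the OPERATOR norm of `∇u` — inside an EQUALITY, whereas the
local energy identity (tree: `IsClassicalNSSolutionOn.local_energy_identity_cutoff`) carries the
FROBENIUS quantity `frobeniusNormSq (fderiv ℝ (u s) x) = Σᵢ ‖∂ᵢu‖²`.  The two differ already for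
the identity map: `‖id‖² = 1` but `|id|²_F = 3`.  So the identity as typed is mis-stated (false for
any slice with `rank ∇u ≥ 2` on `{φ > 0}`); fix: `frobeniusNormSq`.
-/

namespace Summit.NavierStokesRegularity.NavierStokesRegularity.Cruxes.FarPastLedger.TriageR1K3

open Literature.Analysis.FluidPDE

local notation "E3" => EuclideanSpace ℝ (Fin 3)

/-- operator norm of the identity of `ℝ³`, squared -/
example : ‖ContinuousLinearMap.id ℝ E3‖ ^ 2 = 1 := by
  rw [ContinuousLinearMap.norm_id]; norm_num

/-- Frobenius norm² of the identity of `ℝ³` -/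
example : frobeniusNormSq (ContinuousLinearMap.id ℝ E3) = 3 := by
  unfold frobeniusNormSq
  have h1 : ∀ i, ‖(ContinuousLinearMap.id ℝ E3) (stdOrthonormalBasis ℝ E3 i)‖ ^ 2 = 1 := by
    intro i
    rw [ContinuousLinearMap.coe_id', id, (stdOrthonormalBasis ℝ E3).orthonormal.1 i]
    norm_num
  simp only [h1, Finset.sum_const, Finset.card_univ, Fintype.card_fin]
  rw [finrank_euclideanSpace_fin]
  norm_num

/-- hence the two "dissipation densities" disagree -/
example : ‖ContinuousLinearMap.id ℝ E3‖ ^ 2 ≠ frobeniusNormSq (ContinuousLinearMap.id ℝ E3) := by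
  intro h
  have a : ‖ContinuousLinearMap.id ℝ E3‖ ^ 2 = 1 := by
    rw [ContinuousLinearMap.norm_id]; norm_num
  have b : frobeniusNormSq (ContinuousLinearMap.id ℝ E3) = 3 := by
    unfold frobeniusNormSq
    have h1 : ∀ i, ‖(ContinuousLinearMap.id ℝ E3) (stdOrthonormalBasis ℝ E3 i)‖ ^ 2 = 1 := by
      intro i
      rw [ContinuousLinearMap.coe_id', id, (stdOrthonormalBasis ℝ E3).orthonormal.1 i]
      norm_num
    simp only [h1, Finset.sum_const, Finset.card_univ, Fintype.card_fin]
    rw [finrank_euclideanSpace_fin]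
    norm_num
  rw [a, b] at h
  norm_num at h

end Summit.NavierStokesRegularity.NavierStokesRegularity.Cruxes.FarPastLedger.TriageR1K3
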